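import Summits.ResolutionOfSingularities.ResolutionOfSingularities.Theorems.FrobeniusClosingCascade
import Summits.ResolutionOfSingularities.ResolutionOfSingularities.Theorems.WildConesClassicalRegimes
import Summits.ResolutionOfSingularities.ResolutionOfSingularities.Theorems.WildConesAssembly

/-!
# Route `FrobeniusClosing`, crux `ClosingReduction` (stmt-ResolutionOfSingularities-16347) — PROVED
# unconditionally

`ClosingReduction := NoPeriodicIsolatedAtom → BoundedMilnor → IsolatedForcedTermination`. The tree
already holds the conditional proof `Theorems.FrobeniusClosing.ClosingReduction_proof : ClosingLemma →
ClosingReduction` (line `chart-factorization`, seven stubs + the support item `ClosingLemma`,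
stmt-16348). Since the target `IsolatedForcedTermination` is now a theorem
(the `WildCones` engine `Theorems.WildCones.frobeniusClosing_isolatedForcedTermination_of_classicalRegimes`
applied to the `p = 2` Milnor descent `Theorems.WildCones.ClassicalRegimes_proof`; also recorded as
`Theorems.FrobeniusClosing.isolatedForcedTermination_of_landed` in `Theorems/FrobeniusClosingBoundedMilnor.lean`), `ClosingReduction` holds outright by discarding its two hypotheses
(`Theorems.FrobeniusClosing.closingReduction_of_isolatedForcedTermination`,
`Theorems/FrobeniusClosingCascade.lean`). Chain W4.1 (`L/w41/CHAIN.md` v1, cascade F7). [folklore]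
-/

noncomputable section

-- single-problem summit: the doubled namespace component `ResolutionOfSingularities` is forced
set_option linter.dupNamespace false

open Summit.ResolutionOfSingularities.ResolutionOfSingularities.Theses.FrobeniusClosing
  (ClosingReduction)

namespace Summit.ResolutionOfSingularities.ResolutionOfSingularities.Theorems.FrobeniusClosing

/-- **The crux `ClosingReduction` of route `FrobeniusClosing` (stmt-ResolutionOfSingularities-16347),
PROVED unconditionally** (the conditional `ClosingReduction_proof` needs `ClosingLemma`; this one
needs nothing: the target is a theorem). [folklore] -/
theorem ClosingReduction_proofUncond : ClosingReduction :=
  closingReduction_of_isolatedForcedTermination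
    (WildCones.frobeniusClosing_isolatedForcedTermination_of_classicalRegimes
      WildCones.ClassicalRegimes_proof)

end Summit.ResolutionOfSingularities.ResolutionOfSingularities.Theorems.FrobeniusClosing

end
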